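import Summits.BirchSwinnertonDyer.BirchSwinnertonDyer.Theorems.AdditiveKolyvaginRoadLevelSystemsRigidityDichotomy
import HarnessLib

/-!
# Route `AdditiveKolyvaginRoad`, crux `LevelKolyvaginSystemsAdditive` (item stmt-BirchSwinnertonDyer-21396, KS′):
# HOWARD'S CORE GRAPH IS CONNECTED (Lemma 2.4.10, Prop. 2.4.11) over a field with two signs, from the dichotomy and
# Čebotarev — abstract; the `connected` binder of the ignition assemblies DISCHARGED to standard rank inputs
# (cell `pub/bsd-wall`, width seat `bsd-wall-akr-p2x-w2` g2; `--supports stmt-BirchSwinnertonDyer-21396`, helper; part 4b, after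
# `…LevelSystemsRigidityCore` ∕ `…Rigidity` ∕ `…OfIgnition` (parts 1–3) and `…RigidityDichotomy` (part 4a))

WHAT. In the ENGINE currency of part 4a (`Sel`, `T`, `ε`; hypotheses (Inert), (Lower), (Raise), (Cheb), bookkeeping «in»/«out»,
finite-dimensionality, odd bottom rank):
* `eqvGen_coreEdge_of_subset` — HOWARD'S LEMMA 2.4.10: a core level `a` (total rank `≤ 1`) is joined to every core level
  `n ⊇ a` through core edges («`b = b' ∪ {q}`, the odd end has both canonical spaces zero» — the relation of part 1, inline).
  Proof = Howard's induction on `#(n ∖ a)` verbatim, in two signs: an odd core `n` loses any prime of `n ∖ a` (the step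
  below is a lowering step seen from below); an even core `n` whose rank-one generator `s` is DETECTED at a prime `q ∈ n ∖ a`
  loses `q` (the sign of `q` is that of `s` by (Inert), so `n∖q — n` is a raising step and `n ∖ q` has total rank `0`);
  otherwise `s` descends to `Sel_a`, `Sel_n^μ = Sel_a^μ` as lines, and a Čebotarev prime `λ` of sign `μ` detecting `s` gives
  the core path `n — n∪λ — (n∖q)∪λ` to an even core level whose generator IS detected at a prime of its difference with `a`
  (else it would lie in `Sel_a^μ = Sel_n^μ` and be killed at `n∪λ`, or in `Sel_a^{¬μ} = 0`).
* `eqvGen_coreEdge_of_core` — PROP. 2.4.11: ANY two core levels are joined (a common core level above their union, 4a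
  `exists_core_superset`, then Lemma 2.4.10 twice).
* `connected_of_dichotomy` — exactly the `connected` binder of part 3's `nonempty_levelKolyvaginSystemP_of_bipartite_of_seed`
  (every non-empty even level of canonical rank one is joined to a fixed core level `n₀`).
CONSEQUENCE (parts 1–4 together, Howard's rigidity Thm. 2.5.1 in the tree's two-sign `𝔽_p`-currency): the carrier's `baseCase`
⟸ ONE seed at a core level + (Inert) ∕ (Lower) ∕ (Raise) ∕ (Cheb) + odd bottom rank — no rank-0 anchor at every level.

HONEST FRAMING: pure linear algebra + combinatorics; 0 definitions, 0 named facts, 0 `sorry`; all rank statements are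
HYPOTHESES (for the carrier: (Lower) ∕ (Cheb) landed in existential ∕ signed form, (Raise) modulo Poitou–Tate, (Inert) landed
in parts); closes nothing. BSD is not proved by any of this.

References: [cite: Howard2006Bipartite, Lemma 2.4.9, Lemma 2.4.10, Prop. 2.4.11, Cor. 2.4.12, Thm. 2.5.1] [cite: WZhang2014,
Lemma 5.3, Prop. 5.4, Lemma 7.3, Thm. 7.2, §9] [cite: BertoliniDarmon2005, Thm. 3.2].
-/

noncomputable section

open scoped Classical

namespace Summit.BirchSwinnertonDyer.Rank1Residual.X11b.Three.Koly.CoreGraph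

open Module

variable {F : Type*} [Field F] {H : Type*} [AddCommGroup H] [Module F H] {Q : Type*} [DecidableEq Q]
  (Sel : Finset Q → Bool → Submodule F H) (T : Q → H → Prop) (ε : Q → Bool)

/-! ## §3 Connectivity of the core graph (Howard Lemma 2.4.10, Prop. 2.4.11) -/

/-- **Howard's Lemma 2.4.10 over a field, two signs**: a CORE level `a` (total rank `≤ 1`) is joined to every core level
`n ⊇ a` through core edges («`b = b' ∪ {q}`, the odd end has both canonical spaces zero» — the relation of part 1, inline),
GIVEN finite-dimensionality, the bookkeeping «in»/«out», (Inert) with its companion «a `(¬ε q)`-eigenclass is locally trivial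
above `q`», the dichotomy (Lower)/(Raise), (Cheb) and odd total rank at the bottom. Proof = Howard's induction on `#(n ∖ a)`:
an odd core `n` loses any prime of `n ∖ a` along a core edge; an even core `n` whose generator is detected at a prime `q` of
`n ∖ a` loses `q` (the sign of `q` is that of the generator, so the level below is a raising step, of total rank `0`);
otherwise the generator descends to `Sel_a`, `Sel_n^μ = Sel_a^μ`, and a Čebotarev prime `λ` detecting it gives the core path
`n — n∪λ — (n∖q)∪λ` to an even core level whose generator IS detected at a prime of its difference with `a`.
[cite: Howard2006Bipartite, Lemma 2.4.10] [cite: WZhang2014, Prop. 5.4, Lemma 7.3, §9] -/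
theorem eqvGen_coreEdge_of_subset (hfin : ∀ (m : Finset Q) (μ : Bool), Module.Finite F (Sel m μ))
    (hIn : ∀ (n : Finset Q) (q : Q) (μ : Bool) (y : H), q ∉ n → y ∈ Sel n μ → T q y → y ∈ Sel (insert q n) μ)
    (hOut : ∀ (n : Finset Q) (q : Q) (μ : Bool) (z : H), q ∉ n → z ∈ Sel (insert q n) μ → T q z → z ∈ Sel n μ)
    (hInert : ∀ (m : Finset Q) (q : Q), q ∉ m → Sel (insert q m) (!ε q) = Sel m (!ε q))
    (hInertT : ∀ (m : Finset Q) (q : Q) (y : H), y ∈ Sel m (!ε q) → T q y)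
    (hLower : ∀ (m : Finset Q) (q : Q), q ∉ m → (∃ x ∈ Sel m (ε q), ¬ T q x) →
      Sel (insert q m) (ε q) ≤ Sel m (ε q) ∧ finrank F (Sel (insert q m) (ε q)) + 1 = finrank F (Sel m (ε q)) ∧
      ∀ y ∈ Sel (insert q m) (ε q), T q y)
    (hRaise : ∀ (m : Finset Q) (q : Q), q ∉ m → (∀ x ∈ Sel m (ε q), T q x) →
      Sel m (ε q) ≤ Sel (insert q m) (ε q) ∧ finrank F (Sel (insert q m) (ε q)) = finrank F (Sel m (ε q)) + 1)
    (hCheb : ∀ (B m : Finset Q) (μ : Bool) (x : H), x ∈ Sel m μ → x ≠ 0 → ∃ q, q ∉ B ∧ ε q = μ ∧ ¬ T q x)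
    (hodd : Odd (finrank F (Sel ∅ true) + finrank F (Sel ∅ false))) {a n : Finset Q}
    (ha : finrank F (Sel a true) + finrank F (Sel a false) ≤ 1)
    (hn : finrank F (Sel n true) + finrank F (Sel n false) ≤ 1) (han : a ⊆ n) :
    Relation.EqvGen (fun a b : Finset Q ↦ ∃ q, q ∉ a ∧ b = insert q a ∧
        (Even a.card → Sel (insert q a) true = ⊥ ∧ Sel (insert q a) false = ⊥) ∧
        (Odd a.card → Sel a true = ⊥ ∧ Sel a false = ⊥)) a n := by
  set E : Finset Q → Finset Q → Prop := fun a b ↦ ∃ q, q ∉ a ∧ b = insert q a ∧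
      (Even a.card → Sel (insert q a) true = ⊥ ∧ Sel (insert q a) false = ⊥) ∧
      (Odd a.card → Sel a true = ⊥ ∧ Sel a false = ⊥) with hE
  -- total rank, parity, the rank of a core level by parity
  have hpar := odd_total_iff_even_card Sel T ε hInert hLower hRaise hodd
  have hcore_even : ∀ m : Finset Q, finrank F (Sel m true) + finrank F (Sel m false) ≤ 1 → Even m.card →
      finrank F (Sel m true) + finrank F (Sel m false) = 1 := fun m hm he ↦ by
    obtain ⟨t, ht⟩ := (hpar m).mpr he
    omega
  have hcore_odd : ∀ m : Finset Q, finrank F (Sel m true) + finrank F (Sel m false) ≤ 1 → Odd m.card →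
      finrank F (Sel m true) + finrank F (Sel m false) = 0 := fun m hm ho ↦ by
    have h : ¬ Odd (finrank F (Sel m true) + finrank F (Sel m false)) :=
      fun h ↦ (Nat.not_even_iff_odd.mpr ho) ((hpar m).mp h)
    rcases (show finrank F (Sel m true) + finrank F (Sel m false) = 0 ∨
        finrank F (Sel m true) + finrank F (Sel m false) = 1 by omega) with h0 | h1
    · exact h0
    · exact absurd ⟨0, by omega⟩ h
  -- induction on the size of `n ∖ a`
  suffices H : ∀ (k : ℕ) (n : Finset Q), finrank F (Sel n true) + finrank F (Sel n false) ≤ 1 → a ⊆ n →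
      (n \ a).card = k → Relation.EqvGen E a n from H _ n hn han rfl
  intro k
  induction k using Nat.strong_induction_on with
  | _ k ih =>
    intro n hn han hk
    rcases Nat.eq_zero_or_pos k with rfl | hkpos
    · have hna : n = a :=
        Finset.Subset.antisymm (Finset.sdiff_eq_empty_iff_subset.mp (Finset.card_eq_zero.mp hk)) han
      rw [hna]
      exact Relation.EqvGen.refl a
    -- (B1) an even level above `a` whose rank-one generator is detected at a prime of its difference with `a`
    have B1 : ∀ (n' : Finset Q) (μ' : Bool) (s' : H), a ⊆ n' → (n' \ a).card = k →
        finrank F (Sel n' μ') = 1 → Sel n' (!μ') = ⊥ → s' ∈ Sel n' μ' →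
        (∃ q ∈ n' \ a, ¬ T q s') → Relation.EqvGen E a n' := by
      intro n' μ' s' han' hk' h1 h0 hs' hdet
      obtain ⟨q, hq, hDq⟩ := hdet
      obtain ⟨hqn', hqa⟩ := Finset.mem_sdiff.mp hq
      have hqm : q ∉ n'.erase q := Finset.notMem_erase q n'
      have hins : insert q (n'.erase q) = n' := Finset.insert_erase hqn'
      -- the sign of `q` is the sign of the detected class
      have hεq : ε q = μ' := by
        by_contra hne
        have hμ' : μ' = !ε q := by
          revert hne
          cases μ' <;> cases ε q <;> decide
        exact hDq (hInertT n' q s' (hμ' ▸ hs'))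
      -- the step `n' ∖ q — n'` is a RAISING step: lowering would make `s'` locally trivial above `q`
      have hund : ∀ x ∈ Sel (n'.erase q) (ε q), T q x := by
        intro x hx
        by_contra hTx
        obtain ⟨-, -, hall⟩ := hLower (n'.erase q) q hqm ⟨x, hx, hTx⟩
        exact hDq (hall s' (by rw [hins, hεq]; exact hs'))
      have hstep := total_insert_of_undetected Sel T ε hInert hRaise hqm hund
      rw [hins] at hstep
      haveI := hfin n' (!μ')
      have hr1 : finrank F (Sel n' true) + finrank F (Sel n' false) = 1 := by
        rw [← finrank_add_finrank_not Sel n' μ', h1, h0, finrank_bot]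
      have hm0 : finrank F (Sel (n'.erase q) true) + finrank F (Sel (n'.erase q) false) = 0 := by omega
      obtain ⟨hmt, hmf⟩ := eq_bot_and_eq_bot_of_total_eq_zero Sel hfin hm0
      have hn'e : Even n'.card := (hpar n').mp (by rw [hr1]; exact odd_one)
      have hmo : Odd (n'.erase q).card := by
        rw [Finset.card_erase_of_mem hqn']
        have hc : 1 ≤ n'.card := Finset.card_pos.mpr ⟨q, hqn'⟩
        obtain ⟨t, ht⟩ := hn'e
        exact ⟨t - 1, by omega⟩
      have hedge : E (n'.erase q) n' :=
        ⟨q, hqm, hins.symm, fun he ↦ absurd he (Nat.not_even_iff_odd.mpr hmo), fun _ ↦ ⟨hmt, hmf⟩⟩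
      have hma : a ⊆ n'.erase q := fun x hx ↦ Finset.mem_erase.mpr ⟨fun h ↦ hqa (h ▸ hx), han' hx⟩
      have hcard : (n'.erase q \ a).card = k - 1 := by
        rw [Finset.card_sdiff_of_subset hma, Finset.card_erase_of_mem hqn', ← hk',
          Finset.card_sdiff_of_subset han']
        omega
      exact Relation.EqvGen.trans _ _ _ (ih (k - 1) (by omega) (n'.erase q) (by omega) hma hcard)
        (Relation.EqvGen.rel _ _ hedge)
    rcases Nat.even_or_odd n.card with hne | hno
    · -- `n` even core: total rank one, generator `s` of sign `μ`
      have hr1 : finrank F (Sel n true) + finrank F (Sel n false) = 1 := hcore_even n hn hne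
      obtain ⟨μ, s, h1, h0, hs, hs0, hgen⟩ := exists_generator_of_total_eq_one Sel hfin hr1
      by_cases hB : ∃ q ∈ n \ a, ¬ T q s
      · exact B1 n μ s han hk h1 h0 hs hB
      · push Not at hB
        -- (B2) `s` is locally trivial above every prime of `n ∖ a`: it descends to level `a`
        have hsa : s ∈ Sel a μ :=
          mem_of_forall_triv Sel T hOut (n \ a) (fun q hq _ ↦ hB q hq)
            (by rw [Finset.union_sdiff_of_subset han]; exact hs)
        -- `a` is an even core level and `Sel_n^μ = Sel_a^μ`
        have hra : finrank F (Sel a true) + finrank F (Sel a false) = 1 := by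
          rcases Nat.even_or_odd a.card with hae | hao
          · exact hcore_even a ha hae
          · exfalso
            obtain ⟨hat, haf⟩ := eq_bot_and_eq_bot_of_total_eq_zero Sel hfin (hcore_odd a ha hao)
            have hbot : Sel a μ = ⊥ := by
              cases μ
              · exact haf
              · exact hat
            rw [hbot, Submodule.mem_bot] at hsa
            exact hs0 hsa
        have hle : Sel n μ ≤ Sel a μ := fun y hy ↦ by
          obtain ⟨c, rfl⟩ := hgen y hy
          exact Submodule.smul_mem _ c hsa
        haveI := hfin a μ
        have ha1 : finrank F (Sel a μ) = 1 := by
          have hpos : finrank F (Sel a μ) ≠ 0 := fun h0' ↦ by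
            rw [Submodule.finrank_eq_zero.mp h0', Submodule.mem_bot] at hsa
            exact hs0 hsa
          have := finrank_add_finrank_not Sel a μ
          omega
        have heq : Sel n μ = Sel a μ := Submodule.eq_of_le_of_finrank_eq hle (by rw [h1, ha1])
        -- a prime `q` of the difference and a Čebotarev prime `lam` of sign `μ` detecting `s`
        obtain ⟨q, hq⟩ : (n \ a).Nonempty := Finset.card_pos.mp (by omega)
        obtain ⟨hqn, hqa⟩ := Finset.mem_sdiff.mp hq
        obtain ⟨lam, hlam, hεlam, hDlam⟩ := hCheb n n μ s hs hs0
        have hlam_a : lam ∉ a := fun h ↦ hlam (han h)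
        have hql : q ≠ lam := fun h ↦ hlam (h ▸ hqn)
        have hsε : ∃ x ∈ Sel n (ε lam), ¬ T lam x := ⟨s, by rw [hεlam]; exact hs, hDlam⟩
        -- `n₁ = n ∪ lam` is an odd core level: the edge `n — n₁`
        have hr₁ : finrank F (Sel (insert lam n) true) + finrank F (Sel (insert lam n) false) = 0 := by
          have := total_insert_of_detected Sel T ε hInert hLower hlam hsε
          omega
        obtain ⟨h₁t, h₁f⟩ := eq_bot_and_eq_bot_of_total_eq_zero Sel hfin hr₁
        have hE₁ : E n (insert lam n) :=
          ⟨lam, hlam, rfl, fun _ ↦ ⟨h₁t, h₁f⟩, fun ho ↦ absurd hne (Nat.not_even_iff_odd.mpr ho)⟩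
        -- `n' = (n ∖ q) ∪ lam`, with `n' ∪ q = n₁`: the edge `n' — n₁`
        have hqm : q ∉ n.erase q := Finset.notMem_erase q n
        have hins : insert q (n.erase q) = n := Finset.insert_erase hqn
        have hlam_m : lam ∉ n.erase q := fun h ↦ hlam (Finset.mem_of_mem_erase h)
        have hq_n' : q ∉ insert lam (n.erase q) := by
          rw [Finset.mem_insert, not_or]
          exact ⟨hql, hqm⟩
        have hins' : insert q (insert lam (n.erase q)) = insert lam n := by rw [Finset.insert_comm, hins]
        have hn'e : Even (insert lam (n.erase q)).card := by
          rw [Finset.card_insert_of_notMem hlam_m, Finset.card_erase_of_mem hqn]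
          have hc : 1 ≤ n.card := Finset.card_pos.mpr ⟨q, hqn⟩
          obtain ⟨t, ht⟩ := hne
          exact ⟨t, by omega⟩
        have hE₂ : E (insert lam (n.erase q)) (insert lam n) :=
          ⟨q, hq_n', hins'.symm, fun _ ↦ by rw [hins']; exact ⟨h₁t, h₁f⟩,
            fun ho ↦ absurd hn'e (Nat.not_even_iff_odd.mpr ho)⟩
        -- `n'` has total rank one: `s ∈ Sel_{n∖q}^μ` (out), the step `n∖q — n` lowers (else `s = 0`), the step
        -- `n∖q — n'` lowers at `lam`
        have hsm : s ∈ Sel (n.erase q) μ := hOut (n.erase q) q μ s hqm (by rw [hins]; exact hs) (hB q hq)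
        have hrm : finrank F (Sel (n.erase q) true) + finrank F (Sel (n.erase q) false) = 2 := by
          by_cases hx : ∃ x ∈ Sel (n.erase q) (ε q), ¬ T q x
          · have := total_insert_of_detected Sel T ε hInert hLower hqm hx
            rw [hins] at this
            omega
          · push Not at hx
            have := total_insert_of_undetected Sel T ε hInert hRaise hqm hx
            rw [hins] at this
            exfalso
            obtain ⟨hmt, hmf⟩ := eq_bot_and_eq_bot_of_total_eq_zero Sel hfin
              (show finrank F (Sel (n.erase q) true) + finrank F (Sel (n.erase q) false) = 0 by omega)
            have hbot : Sel (n.erase q) μ = ⊥ := by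
              cases μ
              · exact hmf
              · exact hmt
            rw [hbot, Submodule.mem_bot] at hsm
            exact hs0 hsm
        have hr' : finrank F (Sel (insert lam (n.erase q)) true) +
            finrank F (Sel (insert lam (n.erase q)) false) = 1 := by
          have := total_insert_of_detected Sel T ε hInert hLower hlam_m ⟨s, by rw [hεlam]; exact hsm, hDlam⟩
          omega
        obtain ⟨μ', s', h1', h0', hs', hs'0, -⟩ := exists_generator_of_total_eq_one Sel hfin hr'
        have ha' : a ⊆ insert lam (n.erase q) := fun x hx ↦
          Finset.mem_insert_of_mem (Finset.mem_erase.mpr ⟨fun h ↦ hqa (h ▸ hx), han hx⟩)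
        -- Howard's final contradiction: the new generator IS detected at a prime of `n' ∖ a`
        have hdet : ∃ r ∈ insert lam (n.erase q) \ a, ¬ T r s' := by
          by_contra hall
          push Not at hall
          have hs'a : s' ∈ Sel a μ' :=
            mem_of_forall_triv Sel T hOut (insert lam (n.erase q) \ a) (fun r hr _ ↦ hall r hr)
              (by rw [Finset.union_sdiff_of_subset ha']; exact hs')
          by_cases hμ : μ' = μ
          · rw [hμ, ← heq] at hs'a
            have hlam_mem : lam ∈ insert lam (n.erase q) \ a :=
              Finset.mem_sdiff.mpr ⟨Finset.mem_insert_self lam _, hlam_a⟩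
            have hmem := hIn n lam μ s' hlam hs'a (hall lam hlam_mem)
            have hbot : Sel (insert lam n) μ = ⊥ := by
              cases μ
              · exact h₁f
              · exact h₁t
            rw [hbot, Submodule.mem_bot] at hmem
            exact hs'0 hmem
          · have hμ' : μ' = !μ := by
              revert hμ
              cases μ' <;> cases μ <;> decide
            haveI := hfin a (!μ)
            have ha0 : finrank F (Sel a (!μ)) = 0 := by
              have := finrank_add_finrank_not Sel a μ
              omega
            rw [hμ', Submodule.finrank_eq_zero.mp ha0, Submodule.mem_bot] at hs'a
            exact hs'0 hs'a
        have hk' : (insert lam (n.erase q) \ a).card = k := by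
          rw [Finset.card_sdiff_of_subset ha', Finset.card_insert_of_notMem hlam_m, Finset.card_erase_of_mem hqn,
            ← hk, Finset.card_sdiff_of_subset han]
          have hc : 1 ≤ n.card := Finset.card_pos.mpr ⟨q, hqn⟩
          omega
        have hpath := B1 (insert lam (n.erase q)) μ' s' ha' hk' h1' h0' hs' hdet
        -- compose `a ~ n' — n₁ — n`
        exact Relation.EqvGen.trans _ _ _ hpath (Relation.EqvGen.trans _ _ _ (Relation.EqvGen.rel _ _ hE₂)
          (Relation.EqvGen.symm _ _ (Relation.EqvGen.rel _ _ hE₁)))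
    · -- `n` odd core: total rank zero; remove any prime of `n ∖ a` (a lowering step seen from below)
      have hr0 : finrank F (Sel n true) + finrank F (Sel n false) = 0 := hcore_odd n hn hno
      obtain ⟨q, hq⟩ : (n \ a).Nonempty := Finset.card_pos.mp (by omega)
      obtain ⟨hqn, hqa⟩ := Finset.mem_sdiff.mp hq
      have hqm : q ∉ n.erase q := Finset.notMem_erase q n
      have hins : insert q (n.erase q) = n := Finset.insert_erase hqn
      have hrm : finrank F (Sel (n.erase q) true) + finrank F (Sel (n.erase q) false) = 1 := by
        by_cases hx : ∃ x ∈ Sel (n.erase q) (ε q), ¬ T q x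
        · have := total_insert_of_detected Sel T ε hInert hLower hqm hx
          rw [hins] at this
          omega
        · push Not at hx
          have := total_insert_of_undetected Sel T ε hInert hRaise hqm hx
          rw [hins] at this
          omega
      obtain ⟨hnt, hnf⟩ := eq_bot_and_eq_bot_of_total_eq_zero Sel hfin hr0
      have hme : Even (n.erase q).card := by
        rw [Finset.card_erase_of_mem hqn]
        obtain ⟨t, ht⟩ := hno
        exact ⟨t, by omega⟩
      have hedge : E (n.erase q) n :=
        ⟨q, hqm, hins.symm, fun _ ↦ by rw [hins]; exact ⟨hnt, hnf⟩, fun ho ↦ absurd hme (Nat.not_even_iff_odd.mpr ho)⟩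
      have hma : a ⊆ n.erase q := fun x hx ↦ Finset.mem_erase.mpr ⟨fun h ↦ hqa (h ▸ hx), han hx⟩
      have hcard : (n.erase q \ a).card = k - 1 := by
        rw [Finset.card_sdiff_of_subset hma, Finset.card_erase_of_mem hqn, ← hk, Finset.card_sdiff_of_subset han]
        omega
      exact Relation.EqvGen.trans _ _ _ (ih (k - 1) (by omega) (n.erase q) (by omega) hma hcard)
        (Relation.EqvGen.rel _ _ hedge)

/-- **Howard's Proposition 2.4.11 over a field, two signs: THE CORE GRAPH IS CONNECTED.** Any two core levels (total rank
`≤ 1`) are joined through core edges — via a common core level above their union (Lemma 2.4.9) and Lemma 2.4.10 twice.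
[cite: Howard2006Bipartite, Prop. 2.4.11, Lemma 2.4.9, Lemma 2.4.10] -/
theorem eqvGen_coreEdge_of_core (hfin : ∀ (m : Finset Q) (μ : Bool), Module.Finite F (Sel m μ))
    (hIn : ∀ (n : Finset Q) (q : Q) (μ : Bool) (y : H), q ∉ n → y ∈ Sel n μ → T q y → y ∈ Sel (insert q n) μ)
    (hOut : ∀ (n : Finset Q) (q : Q) (μ : Bool) (z : H), q ∉ n → z ∈ Sel (insert q n) μ → T q z → z ∈ Sel n μ)
    (hInert : ∀ (m : Finset Q) (q : Q), q ∉ m → Sel (insert q m) (!ε q) = Sel m (!ε q))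
    (hInertT : ∀ (m : Finset Q) (q : Q) (y : H), y ∈ Sel m (!ε q) → T q y)
    (hLower : ∀ (m : Finset Q) (q : Q), q ∉ m → (∃ x ∈ Sel m (ε q), ¬ T q x) →
      Sel (insert q m) (ε q) ≤ Sel m (ε q) ∧ finrank F (Sel (insert q m) (ε q)) + 1 = finrank F (Sel m (ε q)) ∧
      ∀ y ∈ Sel (insert q m) (ε q), T q y)
    (hRaise : ∀ (m : Finset Q) (q : Q), q ∉ m → (∀ x ∈ Sel m (ε q), T q x) →
      Sel m (ε q) ≤ Sel (insert q m) (ε q) ∧ finrank F (Sel (insert q m) (ε q)) = finrank F (Sel m (ε q)) + 1)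
    (hCheb : ∀ (B m : Finset Q) (μ : Bool) (x : H), x ∈ Sel m μ → x ≠ 0 → ∃ q, q ∉ B ∧ ε q = μ ∧ ¬ T q x)
    (hodd : Odd (finrank F (Sel ∅ true) + finrank F (Sel ∅ false))) {a b : Finset Q}
    (ha : finrank F (Sel a true) + finrank F (Sel a false) ≤ 1)
    (hb : finrank F (Sel b true) + finrank F (Sel b false) ≤ 1) :
    Relation.EqvGen (fun a b : Finset Q ↦ ∃ q, q ∉ a ∧ b = insert q a ∧
        (Even a.card → Sel (insert q a) true = ⊥ ∧ Sel (insert q a) false = ⊥) ∧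
        (Odd a.card → Sel a true = ⊥ ∧ Sel a false = ⊥)) a b := by
  obtain ⟨n, hn, hrn⟩ := exists_core_superset Sel T ε hInert hLower hCheb (a ∪ b)
  exact Relation.EqvGen.trans _ _ _
    (eqvGen_coreEdge_of_subset Sel T ε hfin hIn hOut hInert hInertT hLower hRaise hCheb hodd ha hrn
      (Finset.subset_union_left.trans hn))
    (Relation.EqvGen.symm _ _ (eqvGen_coreEdge_of_subset Sel T ε hfin hIn hOut hInert hInertT hLower hRaise hCheb
      hodd hb hrn (Finset.subset_union_right.trans hn)))

/-- **The `connected` binder of part 3's assemblies, from the dichotomy**: every non-empty even level of canonical rank one is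
joined to any fixed core level `n₀` through core edges. With parts 1–3: KS′'s `baseCase` ⟸ ONE seed at a core level +
(Inert) ∕ (Lower) ∕ (Raise) ∕ (Cheb) + odd bottom rank — Howard's rigidity theorem in the tree's two-sign currency.
[cite: Howard2006Bipartite, Prop. 2.4.11, Thm. 2.5.1] [cite: WZhang2014, Thm. 7.2, §9] -/
theorem connected_of_dichotomy (hfin : ∀ (m : Finset Q) (μ : Bool), Module.Finite F (Sel m μ))
    (hIn : ∀ (n : Finset Q) (q : Q) (μ : Bool) (y : H), q ∉ n → y ∈ Sel n μ → T q y → y ∈ Sel (insert q n) μ)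
    (hOut : ∀ (n : Finset Q) (q : Q) (μ : Bool) (z : H), q ∉ n → z ∈ Sel (insert q n) μ → T q z → z ∈ Sel n μ)
    (hInert : ∀ (m : Finset Q) (q : Q), q ∉ m → Sel (insert q m) (!ε q) = Sel m (!ε q))
    (hInertT : ∀ (m : Finset Q) (q : Q) (y : H), y ∈ Sel m (!ε q) → T q y)
    (hLower : ∀ (m : Finset Q) (q : Q), q ∉ m → (∃ x ∈ Sel m (ε q), ¬ T q x) →
      Sel (insert q m) (ε q) ≤ Sel m (ε q) ∧ finrank F (Sel (insert q m) (ε q)) + 1 = finrank F (Sel m (ε q)) ∧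
      ∀ y ∈ Sel (insert q m) (ε q), T q y)
    (hRaise : ∀ (m : Finset Q) (q : Q), q ∉ m → (∀ x ∈ Sel m (ε q), T q x) →
      Sel m (ε q) ≤ Sel (insert q m) (ε q) ∧ finrank F (Sel (insert q m) (ε q)) = finrank F (Sel m (ε q)) + 1)
    (hCheb : ∀ (B m : Finset Q) (μ : Bool) (x : H), x ∈ Sel m μ → x ≠ 0 → ∃ q, q ∉ B ∧ ε q = μ ∧ ¬ T q x)
    (hodd : Odd (finrank F (Sel ∅ true) + finrank F (Sel ∅ false))) {n₀ : Finset Q}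
    (hn₀ : finrank F (Sel n₀ true) + finrank F (Sel n₀ false) ≤ 1) :
    ∀ n : Finset Q, n.Nonempty → Even n.card → finrank F (Sel n true) + finrank F (Sel n false) = 1 →
      Relation.EqvGen (fun a b : Finset Q ↦ ∃ q, q ∉ a ∧ b = insert q a ∧
        (Even a.card → Sel (insert q a) true = ⊥ ∧ Sel (insert q a) false = ⊥) ∧
        (Odd a.card → Sel a true = ⊥ ∧ Sel a false = ⊥)) n₀ n :=
  fun _ _ _ h1 ↦ eqvGen_coreEdge_of_core Sel T ε hfin hIn hOut hInert hInertT hLower hRaise hCheb hodd hn₀ h1.le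

end Summit.BirchSwinnertonDyer.Rank1Residual.X11b.Three.Koly.CoreGraph

end
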